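import Literature.Analysis.FluidPDE.TsaiProfileEndgame
import HarnessLib

/-!
# Route CorkscrewDynamo · crux `CorkscrewProfile` (stmt-NavierStokesRegularity-11282) — tool stub T4: polynomial growth of the rotation-gauged head pressure `Π_A = Π − ⟪A y, U⟫`

Tool stub `stub_rotatedHeadGrowth` of line `registered` (skeleton v10, lead c5): the Liouville step
for rotated Leray profiles `(U, P)` runs through the rotation-gauged head pressure
`Π_A(y) := headPressure a U P y − ⟪A y, U y⟫`, `A : E →L[ℝ] E`, and needs its polynomial growth.
From a uniform bound `‖U‖ ≤ M` and a polynomial bound `|P(y)| ≤ C (1 + ‖y‖)^N` we get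
`|Π_A(y)| ≤ (½M² + C + (a + ‖A‖) M) (1 + ‖y‖)^{N+2}`: the head-pressure part is
`abs_headPressure_le` (Tsai 1998, p. 48) with slope `b = 0`, and the gauge term obeys
`|⟪A y, U y⟫| ≤ ‖A‖ ‖y‖ M ≤ ‖A‖ M (1 + ‖y‖)^{N+2}`.
-/

noncomputable section

open MeasureTheory Set Function Filter Topology InnerProductSpace Metric
open Literature.Analysis.FluidPDE
open scoped RealInnerProductSpace Laplacian ContDiff NNReal ENNReal

namespace Summit.NavierStokesRegularity.NavierStokesRegularity.Theorems.CorkscrewProfile.Birth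

set_option linter.dupNamespace false

variable {E : Type*} [NormedAddCommGroup E] [InnerProductSpace ℝ E] [FiniteDimensional ℝ E]

omit [FiniteDimensional ℝ E] in
/-- **Polynomial growth of the rotation-gauged head pressure.** If `‖U y‖ ≤ M` and
`|P y| ≤ C (1 + ‖y‖)^N` everywhere (`a, M, C ≥ 0`), then for every continuous linear `A`,
`|Π(y) − ⟪A y, U y⟫| ≤ (½M² + C + (a + ‖A‖) M) (1 + ‖y‖)^{N+2}`, where `Π = headPressure a U P`
is Tsai's head pressure `½|U|² + P + a y·U`. The `Π` part is `abs_headPressure_le` with `b = 0`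
(Tsai 1998, p. 48: "`Π(y) = O(|y|^N)`"); the gauge term is bounded by
`‖A y‖ ‖U y‖ ≤ ‖A‖ ‖y‖ M ≤ ‖A‖ M (1 + ‖y‖)^{N+2}`. [cite: Tsai1998, p. 48 (proofs of Theorems 1 and 2)] -/
theorem stub_rotatedHeadGrowth {a M C : ℝ} {N : ℕ} {U : E → E} {P : E → ℝ} (A : E →L[ℝ] E)
    (ha : 0 ≤ a) (hM : 0 ≤ M) (hC : 0 ≤ C)
    (hU : ∀ y, ‖U y‖ ≤ M) (hP : ∀ y, |P y| ≤ C * (1 + ‖y‖) ^ N) (y : E) :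
    |headPressure a U P y - ⟪A y, U y⟫| ≤ (2⁻¹ * M ^ 2 + C + (a + ‖A‖) * M) * (1 + ‖y‖) ^ (N + 2) := by
  have hU' : ∀ z, ‖U z‖ ≤ M + 0 * ‖z‖ := fun z => by
    rw [zero_mul, add_zero]
    exact hU z
  have hHead : |headPressure a U P y| ≤ (2⁻¹ * M ^ 2 + C + a * M) * (1 + ‖y‖) ^ (N + 2) := by
    simpa only [add_zero] using abs_headPressure_le ha le_rfl hM hC hU' hP y
  have ht1 : 1 ≤ 1 + ‖y‖ := by linarith [norm_nonneg y]
  have hyt : ‖y‖ ≤ (1 + ‖y‖) ^ (N + 2) :=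
    calc ‖y‖ ≤ 1 + ‖y‖ := by linarith
      _ ≤ (1 + ‖y‖) ^ (N + 2) := le_self_pow₀ ht1 (by omega)
  have hA : |⟪A y, U y⟫| ≤ ‖A‖ * M * (1 + ‖y‖) ^ (N + 2) :=
    calc |⟪A y, U y⟫| ≤ ‖A y‖ * ‖U y‖ := abs_real_inner_le_norm _ _
      _ ≤ (‖A‖ * ‖y‖) * M := mul_le_mul (A.le_opNorm y) (hU y) (norm_nonneg _) (by positivity)
      _ ≤ (‖A‖ * (1 + ‖y‖) ^ (N + 2)) * M := by gcongr
      _ = ‖A‖ * M * (1 + ‖y‖) ^ (N + 2) := by ring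
  calc |headPressure a U P y - ⟪A y, U y⟫| ≤ |headPressure a U P y| + |⟪A y, U y⟫| := abs_sub _ _
    _ ≤ (2⁻¹ * M ^ 2 + C + a * M) * (1 + ‖y‖) ^ (N + 2) + ‖A‖ * M * (1 + ‖y‖) ^ (N + 2) :=
        add_le_add hHead hA
    _ = (2⁻¹ * M ^ 2 + C + (a + ‖A‖) * M) * (1 + ‖y‖) ^ (N + 2) := by ring

end Summit.NavierStokesRegularity.NavierStokesRegularity.Theorems.CorkscrewProfile.Birth
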